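import Summits.RiemannHypothesis.RiemannHypothesis.Theorems.SpectralTraceWindowStepConjugateSplit
import Summits.RiemannHypothesis.RiemannHypothesis.Theorems.SpectralTraceWindowStepFirstRungRegular
import HarnessLib

/-!
# The interior child's first octave IS the sibling crux (line `conjugate-point`, calibration)

Crux `stmt-RiemannHypothesis-14659` (`SpectralTrace.WindowStep`), line `conjugate-point`, held stub
`stub_crystRegular` = child 1 `CrystRegular` of the prepared route split
(`Theorems/SpectralTraceWindowStepConjugateSplit.lean`):
`∀ B ≥ log 2, WindowTraceArch → 0 < ε(B/2) → Trace B`.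

Kernel-checked bookkeeping used by the lead's `blocked-on` verdict and by the planners:

* `crystRegular_first_octave_iff` — `CrystRegular` RESTRICTED to the first octave `B ∈ [log 2, log 3]`
  is EQUIVALENT to `WindowTraceArch → WindowTracePrime2`: (→) at `B = log 3`, because `(log 3)/2` is
  regular (`weilGroundEnergy_log_three_half_pos`, p141362); (←) a rung at `log 3` serves every lower
  level (`windowTrace_anti`). So the weakest contentful instance of the held stub is implied outright
  by the EXISTING sibling item `WindowTracePrime2` (stmt-RiemannHypothesis-11196), and any proof of the
  stub proves that item from the seed.
* `crystRegular_iff_prime2_and_above` — `CrystRegular ↔ (WindowTraceArch → WindowTracePrime2) ∧`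
  (the levels `B > log 3`): the stub splits EXACTLY into the sibling crux and the rest of the ladder.
* `windowTracePrime2_of_windowStep_of_windowTraceArch` — for the record, the crux's own `n = 2`
  instance is the same implication (casts `((2 : ℕ) : ℝ) = 2`, `(2 : ℝ) + 1 = 3`).
* `windowStep_iff_prime2_and_upper_dichotomy` — hence the exact split reads
  `WindowStep ↔ (WindowTraceArch → WindowTracePrime2) ∧ CrystRegular_{> log 3} ∧ NoDegenerateEdge`.

Axioms ⊆ {propext, Classical.choice, Quot.sound}.
-/

set_option linter.dupNamespace false

noncomputable section

open Complex Set Filter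
open scoped Topology

namespace Summit.RiemannHypothesis.RiemannHypothesis.Theorems.SpectralTraceWindowStep

open Literature.NumberTheory.LFunctions
open Summit.RiemannHypothesis.RiemannHypothesis.Theses.SpectralTrace
open Summit.RiemannHypothesis.RiemannHypothesis.Theorems
open Summit.RiemannHypothesis.RiemannHypothesis.Theorems.WindowStep.Negative

/-- `Trace(A)` (file-local notation, verbatim the shape of `WindowTraceArch` / `WindowStep`). -/
local notation3 "WTrace " A:max => ∃ (ι : Type) (γ : ι → ℝ), ∀ g : ℝ → ℂ, IsWeilTest g →
  tsupport g ⊆ Set.Icc (-A) A →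
    HasSum (fun i => weilMellin g (1 / 2 + (γ i : ℂ) * I)) (weilFunctional g)

/-- **The held stub's first octave is the sibling crux.** `CrystRegular` restricted to
`B ∈ [log 2, log 3]` is equivalent to `WindowTraceArch → WindowTracePrime2`: (→) at `B = log 3` by
`0 < ε((log 3)/2)` (`weilGroundEnergy_log_three_half_pos`); (←) a rung at `log 3` serves every
`B ≤ log 3` (`windowTrace_anti`). [folklore] -/
theorem crystRegular_first_octave_iff :
    (∀ B : ℝ, Real.log 2 ≤ B → B ≤ Real.log 3 →
        Summit.RiemannHypothesis.RiemannHypothesis.Theses.SpectralTrace.WindowTraceArch →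
          0 < Literature.NumberTheory.LFunctions.weilGroundEnergy (B / 2) →
            ∃ (ι : Type) (γ : ι → ℝ), ∀ g : ℝ → ℂ, Literature.NumberTheory.LFunctions.IsWeilTest g →
              tsupport g ⊆ Set.Icc (-B) B →
                HasSum (fun i => Literature.NumberTheory.LFunctions.weilMellin g (1 / 2 + (γ i : ℂ) * Complex.I))
                  (Literature.NumberTheory.LFunctions.weilFunctional g)) ↔
      (Summit.RiemannHypothesis.RiemannHypothesis.Theses.SpectralTrace.WindowTraceArch →
        Summit.RiemannHypothesis.RiemannHypothesis.Theses.SpectralTrace.WindowTracePrime2) := by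
  constructor
  · intro h hArch
    exact h (Real.log 3) (Real.log_le_log two_pos (by norm_num)) le_rfl hArch
      weilGroundEnergy_log_three_half_pos
  · intro h B _ hB3 hArch _
    exact windowTrace_anti hB3 (h hArch)

/-- **`CrystRegular` splits exactly into the sibling crux and the levels above `log 3`.**
[folklore] -/
theorem crystRegular_iff_prime2_and_above :
    (∀ B : ℝ, Real.log 2 ≤ B →
        Summit.RiemannHypothesis.RiemannHypothesis.Theses.SpectralTrace.WindowTraceArch →
          0 < Literature.NumberTheory.LFunctions.weilGroundEnergy (B / 2) →
            ∃ (ι : Type) (γ : ι → ℝ), ∀ g : ℝ → ℂ, Literature.NumberTheory.LFunctions.IsWeilTest g →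
              tsupport g ⊆ Set.Icc (-B) B →
                HasSum (fun i => Literature.NumberTheory.LFunctions.weilMellin g (1 / 2 + (γ i : ℂ) * Complex.I))
                  (Literature.NumberTheory.LFunctions.weilFunctional g)) ↔
      ((Summit.RiemannHypothesis.RiemannHypothesis.Theses.SpectralTrace.WindowTraceArch →
          Summit.RiemannHypothesis.RiemannHypothesis.Theses.SpectralTrace.WindowTracePrime2) ∧
        ∀ B : ℝ, Real.log 3 < B →
          Summit.RiemannHypothesis.RiemannHypothesis.Theses.SpectralTrace.WindowTraceArch →
            0 < Literature.NumberTheory.LFunctions.weilGroundEnergy (B / 2) → WTrace B) := by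
  have h23 : Real.log 2 ≤ Real.log 3 := Real.log_le_log two_pos (by norm_num)
  constructor
  · intro hR
    refine ⟨fun hArch => hR (Real.log 3) h23 hArch weilGroundEnergy_log_three_half_pos,
      fun B hB hArch hε => hR B (h23.trans hB.le) hArch hε⟩
  · rintro ⟨hP, hA⟩ B _ hArch hε
    by_cases hB3 : B ≤ Real.log 3
    · exact windowTrace_anti hB3 (hP hArch)
    · exact hA B (lt_of_not_ge hB3) hArch hε

/-- **The crux's own first instance** (`n = 2`): `WindowStep → WindowTraceArch → WindowTracePrime2`.
[folklore] -/
theorem windowTracePrime2_of_windowStep_of_windowTraceArch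
    (hStep : Summit.RiemannHypothesis.RiemannHypothesis.Theses.SpectralTrace.WindowStep)
    (hArch : Summit.RiemannHypothesis.RiemannHypothesis.Theses.SpectralTrace.WindowTraceArch) :
    Summit.RiemannHypothesis.RiemannHypothesis.Theses.SpectralTrace.WindowTracePrime2 := by
  have h2 : (((2 : ℕ) : ℝ)) = 2 := by norm_num
  have h := hStep 2 le_rfl
  rw [h2] at h
  have h3 : (2 : ℝ) + 1 = 3 := by norm_num
  rw [h3] at h
  exact h hArch

/-- **The exact split with the first octave separated.**
`WindowStep ↔ (WindowTraceArch → WindowTracePrime2) ∧ CrystRegular_{B > log 3} ∧ NoDegenerateEdge`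
(`windowStep_iff_dichotomy` + `crystRegular_iff_prime2_and_above`). [folklore] -/
theorem windowStep_iff_prime2_and_upper_dichotomy :
    Summit.RiemannHypothesis.RiemannHypothesis.Theses.SpectralTrace.WindowStep ↔
      ((Summit.RiemannHypothesis.RiemannHypothesis.Theses.SpectralTrace.WindowTraceArch →
          Summit.RiemannHypothesis.RiemannHypothesis.Theses.SpectralTrace.WindowTracePrime2) ∧
        (∀ B : ℝ, Real.log 3 < B →
          Summit.RiemannHypothesis.RiemannHypothesis.Theses.SpectralTrace.WindowTraceArch →
            0 < Literature.NumberTheory.LFunctions.weilGroundEnergy (B / 2) → WTrace B) ∧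
        (∀ a : ℝ, Real.log 3 / 2 ≤ a → (∀ B : ℝ, 0 < B → B < 2 * a → WTrace B) →
          0 < Literature.NumberTheory.LFunctions.weilGroundEnergy a)) := by
  rw [windowStep_iff_dichotomy, crystRegular_iff_prime2_and_above, and_assoc]

end Summit.RiemannHypothesis.RiemannHypothesis.Theorems.SpectralTraceWindowStep

end
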